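import Summits.HodgeConjecture.HodgeConjecture.Theses.GenericDivisibility

/-!
# Sketch — first lemmas for the crux ideas on `GenericDivisibilityBounded` (stmt-HodgeConjecture-18467)

Two levers, each with its first checkable statement typed over existing declarations:

* `BoundedRestrictionTorsion` (card `formality-denominators`): a uniform bound `e(X)` on the torsion
  order of the restriction `w|_{Z(ℂ)} ∈ H^{2p}(Z(ℂ);ℤ)` of a transcendental integral class `w` to ANY
  proper Zariski-closed `Z`; first lemma `FirstLemmaA : BoundedRestrictionTorsion → C2` (pure
  algebraic topology: Alexander–Lefschetz duality `H_{2p}(X, X∖Z) ≅ H^{2p}(Z)` + UCT on the open).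
* `LevelOneClean ℓ` (card `galois-rigidity-dichotomy`): no non-zero transcendental class is
  divisor-supported mod `ℓ` unless it is divisible by `ℓ`; first lemma `FirstLemmaB`: granted the
  route's support item `TorsionDiesGenerically` (CT–Voisin Thm 3.1), level-one cleanness at ONE prime
  gives C2 for that `X` (bootstrap `ℓ^{r-1} t ≡ 0 mod ℓ^r on an open ⇒ t ≡ 0 mod ℓ on a smaller open`);
  `FirstLemmaB'`: cleanness at infinitely many primes gives C2 with no Bloch–Kato input at all.
-/

namespace Summit.HodgeConjecture.HodgeConjecture.Cruxes.GenericDivisibilityBounded.Sketch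

open Literature.AlgebraicGeometry.Motives Literature.AlgebraicGeometry.HodgeTheory
  Literature.AlgebraicTopology.SingularHomology
open Summit.HodgeConjecture.HodgeConjecture.Theses.GenericDivisibility

/-- The complex points of `X` lying over a subset `Z ⊆ X` (for `Z` Zariski-closed: `Z(ℂ)` with the
analytic topology, a compact subspace of `X(ℂ)`). -/
abbrev complexPointsOver (X : SchemeOver ℂ) (Z : Set X.left) : Type :=
  {P : ComplexPoints X // P.pt ∈ Z}

/-- Restriction `H^i(X(ℂ);ℤ) → H^i(Z(ℂ);ℤ)`. -/
noncomputable abbrev restrictOver (X : SchemeOver ℂ) (Z : Set X.left) (i : ℕ) :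
    singularCohomology ℤ ℤ (ComplexPoints X) i ⟶
      singularCohomology ℤ ℤ (complexPointsOver X Z) i :=
  singularCohomology.map ℤ ℤ
    (⟨Subtype.val, continuous_subtype_val⟩ : C(complexPointsOver X Z, ComplexPoints X)) i

/-- Restriction `H^i(X(ℂ);R) → H^i((X∖Z)(ℂ);R)` for any coefficient ring. -/
noncomputable abbrev restrictCompl (R : Type) [CommRing R] (X : SchemeOver ℂ) (Z : Set X.left)
    (i : ℕ) :
    singularCohomology R R (ComplexPoints X) i ⟶ singularCohomology R R (complexPointsCompl X Z) i :=
  singularCohomology.map R R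
    (⟨Subtype.val, continuous_subtype_val⟩ : C(complexPointsCompl X Z, ComplexPoints X)) i

/-- `w` is TRANSCENDENTAL (`w ∈ T = (N¹_ℚ)^⊥ ∩ H^{2p}(X;ℤ)`), phrased without a pairing: its
restriction to every proper Zariski-closed subset is a torsion class (equivalent by duality:
`ker(H^{2p}(X) → H^{2p}(Z)) ⊗ ℚ = (im H^{2p}_Z(X))^⊥`). -/
def IsTranscendental {X : SchemeOver ℂ} {i : ℕ}
    (w : singularCohomology ℤ ℤ (ComplexPoints X) i) : Prop :=
  ∀ Z : Set X.left, IsClosed Z → Z ≠ Set.univ → ∃ N : ℕ, 1 ≤ N ∧ N • restrictOver X Z i w = 0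

/-- The pointwise form of the crux for a fixed `(p, X)`. -/
def C2At (p : ℕ) (X : SchemeOver ℂ) : Prop :=
  ∀ z : singularCohomology ℤ ℤ (ComplexPoints X) (2 * p),
    (∀ m : ℕ, 1 ≤ m → ∃ Z : Set X.left, IsClosed Z ∧ Z ≠ Set.univ ∧
      ∃ y : singularCohomology ℤ ℤ (complexPointsCompl X Z) (2 * p),
        m • y = restrictCompl ℤ X Z (2 * p) z) →
    singularCohomology.ringChange (Int.castRingHom ℂ) (ComplexPoints X) (2 * p) z ∈
      supportedClasses X (2 * p) 1

/-- Sanity: the crux is exactly `∀ p X, 1 ≤ p → smooth projective → C2At p X`. -/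
theorem genericDivisibilityBounded_iff :
    GenericDivisibilityBounded ↔
      ∀ ⦃p : ℕ⦄ ⦃X : SchemeOver ℂ⦄, 1 ≤ p → IsSmoothProjective (2 * p) X → C2At p X :=
  Iff.rfl

/-! ## Lever A — bounded restriction torsion (formality denominators) -/

/-- **BRT.** For a smooth projective complex `2p`-fold there is ONE integer `e ≥ 1` killing the
(torsion) restriction of every transcendental class to every proper Zariski-closed subset. -/
def BoundedRestrictionTorsion : Prop :=
  ∀ ⦃p : ℕ⦄ ⦃X : SchemeOver ℂ⦄, 1 ≤ p → IsSmoothProjective (2 * p) X →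
    ∃ e : ℕ, 1 ≤ e ∧ ∀ w : singularCohomology ℤ ℤ (ComplexPoints X) (2 * p), IsTranscendental w →
      ∀ Z : Set X.left, IsClosed Z → Z ≠ Set.univ → e • restrictOver X Z (2 * p) w = 0

/-- First lemma of card A (pure topology, no Bloch–Kato): BRT ⇒ C2.  Proof sketch: `z ∉ N¹_ℚ` gives
`w ∈ T` with `⟨z, w⟩ = d ≠ 0`; `e•w|_Z = 0` means `PD(e•w)` comes from `H_{2p}((X∖Z)(ℂ))`
(Alexander–Lefschetz duality), so `e•d` is a period of `z` on every open, while `z|_U = m•y` forces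
all periods on `U` into `mℤ`; take `m > e|d|`. -/
def FirstLemmaA : Prop := BoundedRestrictionTorsion → GenericDivisibilityBounded

/-! ## Lever B — Galois rigidity at level one -/

/-- Level-one cleanness at the prime `ℓ`: a transcendental integral class whose mod-`ℓ` reduction
dies on a non-empty Zariski open is divisible by `ℓ` (i.e. `N¹H^{2p}(X;𝔽_ℓ) ∩ T/ℓT = 0`). -/
def LevelOneClean (ℓ p : ℕ) (X : SchemeOver ℂ) : Prop :=
  ∀ t : singularCohomology ℤ ℤ (ComplexPoints X) (2 * p), IsTranscendental t →
    (∃ Z : Set X.left, IsClosed Z ∧ Z ≠ Set.univ ∧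
      restrictCompl (ZMod ℓ) X Z (2 * p)
        (singularCohomology.ringChange (Int.castRingHom (ZMod ℓ)) (ComplexPoints X) (2 * p) t) = 0) →
    ∃ s : singularCohomology ℤ ℤ (ComplexPoints X) (2 * p), t = ℓ • s

/-- First lemma of card B (the bootstrap): granted `TorsionDiesGenerically` (route support item
stmt-HodgeConjecture-18850 = CT–Voisin 2012 Thm 3.1), cleanness at ONE prime decides C2 for `X`:
`ℓ^{r-1}t ≡ 0 (mod ℓ^r)` on an open ⇒ `ℓ^{r-1}(t - ℓy) = 0` ⇒ dies on a smaller open ⇒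
`t ≡ 0 (mod ℓ)` there; so `(N¹(ℤ/ℓ^r) ∩ T/ℓ^r)[ℓ] ↪ N¹(𝔽_ℓ) ∩ T/ℓ = 0` for all `r`. -/
def FirstLemmaB : Prop :=
  TorsionDiesGenerically →
    ∀ ⦃p : ℕ⦄ ⦃X : SchemeOver ℂ⦄, 1 ≤ p → IsSmoothProjective (2 * p) X →
      (∃ ℓ : ℕ, ℓ.Prime ∧ LevelOneClean ℓ p X) → C2At p X

/-- Variant with NO Bloch–Kato input: cleanness at infinitely many primes already gives C2
(a fixed lattice vector divisible by infinitely many primes is zero). -/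
def FirstLemmaB' : Prop :=
  ∀ ⦃p : ℕ⦄ ⦃X : SchemeOver ℂ⦄, 1 ≤ p → IsSmoothProjective (2 * p) X →
    {ℓ : ℕ | ℓ.Prime ∧ LevelOneClean ℓ p X}.Infinite → C2At p X

end Summit.HodgeConjecture.HodgeConjecture.Cruxes.GenericDivisibilityBounded.Sketch
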